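import Summits.KontsevichZagierPeriods.KontsevichZagierPeriods.Theorems.HyperbolicBlochOffTetraSectorKernelRedSplit
import Summits.KontsevichZagierPeriods.KontsevichZagierPeriods.Theorems.HyperbolicBlochOffTetraSectorKernelStubIdealSpxClass
import Summits.KontsevichZagierPeriods.KontsevichZagierPeriods.Theorems.HyperbolicBlochOffTetraSectorKernelStubConeAbsorptionTwo
import Summits.KontsevichZagierPeriods.KontsevichZagierPeriods.Theorems.HyperbolicBlochOffTetraSectorKernelGlue
import Summits.KontsevichZagierPeriods.KontsevichZagierPeriods.Theorems.MzvKernelInKZ.Negative.ScalingDivision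
import Summits.KontsevichZagierPeriods.KontsevichZagierPeriods.Theorems.HyperbolicBlochOffTetraSectorKernelStubSpxCovariance
import Summits.KontsevichZagierPeriods.KontsevichZagierPeriods.Theorems.HyperbolicBlochOffTetraSectorKernelStubTetraHalving

/-!
# `OffTetraSectorKernel` (stmt-KontsevichZagierPeriods-10557) — line `odd-hyperbolic-ladder` (skeleton v3b),
finite-vertex reduction: all `ℚ̄`-tetrahedra

Lead c2. `red_simplexAbsorptionTwo` (registered sub-goal): every geodesic simplex `Spx v` of `ℍ³` whose four rows are
real algebraic and each either a null future row (ideal vertex) or the lift `Ql q` of an algebraic point of the upper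
half space (finite vertex), with `det v ≠ 0`, carries a representation with integrand `t⁻³`, and TWICE the class of any
such representation is a `ℤ`-combination of standard ideal tetrahedra `[ρ z]` modulo the moves. Induction on the
number of finite vertices: `0` — landed `stub_idealSpxClass`; `1` — landed `stub_coneAbsorptionTwo` after a row
permutation (`redAux_spx_perm`); `≥ 2` — `red_split_step`. With the landed `stub_tetraHalving` and integer division
this puts the class of EVERY `ℚ̄`-tetrahedron in the tetrahedral envelope (`simplex_mem_envelope`), so that every
`ℤ`-linear relation among volumes of `ℚ̄`-tetrahedra and Bloch–Wigner values is a relation among Bloch–Wigner values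
modulo the moves (`simplexRelators_le`, registered: the `ℚ̄`-tetrahedron sector of `ℍ³` IS the Bloch–Wigner sector). [Dupont–Sah 1982, §3:
"P(∂H̄³) maps surjectively onto P(H̄³)" — here its elementary half, exponent 2, inside the calculus]
-/

noncomputable section

open Set MeasureTheory
open Literature.NumberTheory.Transcendental

namespace Summit.KontsevichZagierPeriods.HyperbolicBloch.OffTetraSectorKernel

/-! ### All `ℚ̄`-tetrahedra: finite-vertex reduction -/

/-- **Finite-vertex reduction** (Dupont–Sah): every geodesic simplex of `ℍ³` whose four vertex rows are real algebraic
and each either NULL future (ideal vertex) or the lift `Ql q` of an algebraic point of the upper half space (finite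
vertex), with non-zero determinant, has the absorption property `P`: it carries a representation with integrand
`t⁻³`, and TWICE the class of any such representation is a `ℤ`-combination of standard ideal tetrahedra modulo the
moves. Induction on the number of finite vertices: `0` — `stub_idealSpxClass`; `1` — `stub_coneAbsorptionTwo` after a
row permutation (`redAux_spx_perm`); `≥ 2` — `red_split_step`. [cite: DupontSah1982, §3] -/
theorem red_simplexAbsorptionTwo :
    ∀ (Ql : (Fin 3 → ℝ) → Fin 4 → ℝ)
    (hQl : ∀ p, Ql p = ![p 0 ^ 2 + p 1 ^ 2 + p 2 ^ 2, p 0, p 1, 1])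
    (Spx : (Fin 4 → Fin 4 → ℝ) → Set (Fin 3 → ℝ))
    (hSpx : ∀ v, Spx v = {p | 0 < p 2 ∧ ∀ a, 0 < (Matrix.of v).det * ((Matrix.of v).updateRow a (Ql p)).det})
    (hcov : ∀ (g : (Fin 3 → ℝ) → (Fin 3 → ℝ)) (M : Matrix (Fin 4) (Fin 4) ℝ) (c : (Fin 3 → ℝ) → ℝ), M.det ≠ 0 →
      (∀ p : Fin 3 → ℝ, 0 < p 2 → 0 < c p ∧ 0 < g p 2 ∧ Ql (g p) = c p • M.mulVec (Ql p)) →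
      (∀ p' : Fin 3 → ℝ, 0 < p' 2 → ∃ p : Fin 3 → ℝ, 0 < p 2 ∧ g p = p') →
      ∀ v : Fin 4 → Fin 4 → ℝ, g '' Spx v = Spx (fun i => M.mulVec (v i)))
    (ρ : ℂ → KZ.IntegralRep 3)
    (hρ : ∀ z, IsAlgebraic ℚ z → 0 < z.im →
      (ρ z).domain = idealTetrahedron z ∧ EqOn (ρ z).integrand (fun p => 1 / p 2 ^ 3) (idealTetrahedron z))
    (P : (Fin 4 → Fin 4 → ℝ) → Prop)
    (hP : ∀ v, P v ↔ ((∃ r : KZ.IntegralRep 3, r.domain = Spx v ∧ EqOn r.integrand (fun p => 1 / p 2 ^ 3) r.domain) ∧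
      (∀ r : KZ.IntegralRep 3, r.domain = Spx v → EqOn r.integrand (fun p => 1 / p 2 ^ 3) r.domain →
        ∃ (k : ℕ) (z : Fin k → ℂ) (e : Fin k → ℤ), (∀ i, IsAlgebraic ℚ (z i)) ∧ (∀ i, 0 < (z i).im) ∧
          2 • KZ.of r - ∑ i, e i • KZ.of (ρ (z i)) ∈ KZ.relations)))
    (v : Fin 4 → Fin 4 → ℝ) (hvalg : ∀ i k, IsAlgebraic ℚ (v i k))
    (hrow : ∀ i, (v i 1 ^ 2 + v i 2 ^ 2 = v i 0 * v i 3 ∧ 0 ≤ v i 3 ∧ 0 < v i 0 + v i 3) ∨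
      ∃ q : Fin 3 → ℝ, (∀ k, IsAlgebraic ℚ (q k)) ∧ 0 < q 2 ∧ v i = Ql q)
    (hdet : (Matrix.of v).det ≠ 0),
    P v := by
  intro Ql hQl Spx hSpx hcov ρ hρ P hP v hvalg hrow hdet
  classical
  -- `P` and the data depend on `v` only through its set of rows
  have hPperm : ∀ (σ : Equiv.Perm (Fin 4)) (w : Fin 4 → Fin 4 → ℝ), P (w ∘ σ) ↔ P w := by
    intro σ w; rw [hP, hP, redAux_spx_perm Ql Spx hSpx σ w]
  have hdetperm : ∀ (σ : Equiv.Perm (Fin 4)) (w : Fin 4 → Fin 4 → ℝ),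
      (Matrix.of (w ∘ σ)).det = Equiv.Perm.sign σ * (Matrix.of w).det := by
    intro σ w
    have : Matrix.of (w ∘ σ) = (Matrix.of w).submatrix σ id := by ext i j; rfl
    rw [this, Matrix.det_permute]
  -- a lift of a finite point is not a null row
  have hnotnull : ∀ q : Fin 3 → ℝ, 0 < q 2 →
      ¬ ((Ql q) 1 ^ 2 + (Ql q) 2 ^ 2 = (Ql q) 0 * (Ql q) 3 ∧ 0 ≤ (Ql q) 3 ∧ 0 < (Ql q) 0 + (Ql q) 3) := by
    intro q hq h
    have e := h.1
    rw [hQl] at e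
    simp at e
    nlinarith [pow_pos hq 2]
  -- the set of finite vertices and its cardinality
  set T : (Fin 4 → ℝ) → Prop := fun x => ¬ (x 1 ^ 2 + x 2 ^ 2 = x 0 * x 3 ∧ 0 ≤ x 3 ∧ 0 < x 0 + x 3) with hT
  -- CASE 0: all rows null — ideal simplex
  have ideal_case : ∀ w : Fin 4 → Fin 4 → ℝ, (∀ i k, IsAlgebraic ℚ (w i k)) →
      (∀ i, w i 1 ^ 2 + w i 2 ^ 2 = w i 0 * w i 3 ∧ 0 ≤ w i 3 ∧ 0 < w i 0 + w i 3) → (Matrix.of w).det ≠ 0 → P w := by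
    intro w hwalg hwnull hwdet
    obtain ⟨hex, hcls⟩ := stub_idealSpxClass Ql hQl Spx hSpx hcov ρ hρ w hwalg hwnull hwdet
    refine (hP w).mpr ⟨hex, fun r hr hri => ?_⟩
    obtain ⟨z, ε, hz, hzi, -, hc⟩ := hcls r hr hri
    refine ⟨2, ![z, z], ![ε, ε], ?_, ?_, ?_⟩
    · intro i; fin_cases i <;> exact hz
    · intro i; fin_cases i <;> exact hzi
    · rw [Fin.sum_univ_two]
      simp only [Matrix.cons_val_zero, Matrix.cons_val_one]
      have key : 2 • KZ.of r - (ε • KZ.of (ρ z) + ε • KZ.of (ρ z)) =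
          (KZ.of r - ε • KZ.of (ρ z)) + (KZ.of r - ε • KZ.of (ρ z)) := by rw [two_nsmul]; abel
      rw [key]
      exact add_mem hc hc
  -- CASE 1: exactly the rows outside a singleton are null — a cone after a row permutation
  have cone_case : ∀ (w : Fin 4 → Fin 4 → ℝ) (i₀ : Fin 4) (q₀ : Fin 3 → ℝ), (∀ i k, IsAlgebraic ℚ (w i k)) →
      (∀ k, IsAlgebraic ℚ (q₀ k)) → 0 < q₀ 2 → w i₀ = Ql q₀ →
      (∀ i, i ≠ i₀ → w i 1 ^ 2 + w i 2 ^ 2 = w i 0 * w i 3 ∧ 0 ≤ w i 3 ∧ 0 < w i 0 + w i 3) →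
      (Matrix.of w).det ≠ 0 → P w := by
    intro w i₀ q₀ hwalg hq₀ hq₀2 hwi₀ hwnull hwdet
    set σ : Equiv.Perm (Fin 4) := Equiv.swap 0 i₀ with hσ
    set w' : Fin 4 → Fin 4 → ℝ := w ∘ σ with hw'
    have hw'0 : w' 0 = Ql q₀ := by simp [hw', hσ, Equiv.swap_apply_left, hwi₀]
    set n : Fin 3 → Fin 4 → ℝ := fun j => w' j.succ with hn
    have hcons : Matrix.vecCons (Ql q₀) n = w' := by
      rw [← hw'0]; exact Fin.cons_self_tail w'
    have hnsucc : ∀ j : Fin 3, σ j.succ ≠ i₀ := by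
      intro j h
      have : j.succ = σ.symm i₀ := by rw [← h, Equiv.symm_apply_apply]
      rw [hσ, Equiv.symm_swap, Equiv.swap_apply_right] at this
      exact Fin.succ_ne_zero j this
    have hnalg : ∀ j k, IsAlgebraic ℚ (n j k) := fun j k => hwalg _ k
    have hnnull : ∀ j, n j 1 ^ 2 + n j 2 ^ 2 = n j 0 * n j 3 ∧ 0 ≤ n j 3 ∧ 0 < n j 0 + n j 3 :=
      fun j => hwnull _ (hnsucc j)
    have hdet' : (Matrix.of (Matrix.vecCons (Ql q₀) n)).det ≠ 0 := by
      rw [hcons, hw', hdetperm]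
      exact mul_ne_zero (by rcases Int.units_eq_one_or (Equiv.Perm.sign σ) with h | h <;> simp [h]) hwdet
    obtain ⟨hex, hcls⟩ := stub_coneAbsorptionTwo Ql hQl Spx hSpx ρ hρ q₀ hq₀ hq₀2 n hnalg hnnull hdet'
    rw [hcons] at hex hcls
    have : P w' := (hP w').mpr ⟨hex, hcls⟩
    rwa [hw', hPperm] at this
  -- counting finite vertices; strong induction
  suffices H : ∀ (m : ℕ) (w : Fin 4 → Fin 4 → ℝ), (∀ i k, IsAlgebraic ℚ (w i k)) →
      (∀ i, (w i 1 ^ 2 + w i 2 ^ 2 = w i 0 * w i 3 ∧ 0 ≤ w i 3 ∧ 0 < w i 0 + w i 3) ∨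
        ∃ q : Fin 3 → ℝ, (∀ k, IsAlgebraic ℚ (q k)) ∧ 0 < q 2 ∧ w i = Ql q) →
      (Matrix.of w).det ≠ 0 → (Finset.univ.filter fun i => T (w i)).card ≤ m → P w by
    exact H 4 v hvalg hrow hdet (by simpa using Finset.card_le_univ (Finset.univ.filter fun i => T (v i)))
  intro m
  induction m with
  | zero =>
    intro w hwalg hwrow hwdet hcard
    have hall : ∀ i, ¬ T (w i) := by
      intro i hi
      have : i ∈ Finset.univ.filter fun i => T (w i) := by simp [hi]
      have h0 : (Finset.univ.filter fun i => T (w i)) = ∅ := Finset.card_eq_zero.mp (Nat.le_zero.mp hcard)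
      rw [h0] at this
      simp at this
    exact ideal_case w hwalg (fun i => not_not.mp (hall i)) hwdet
  | succ m IH =>
    intro w hwalg hwrow hwdet hcard
    by_cases h2 : 2 ≤ (Finset.univ.filter fun i => T (w i)).card
    · -- two finite vertices `i₀ ≠ i₁`
      obtain ⟨i₀, hi₀, i₁, hi₁, hne01⟩ := Finset.one_lt_card.mp h2
      simp only [Finset.mem_filter, Finset.mem_univ, true_and] at hi₀ hi₁
      obtain ⟨q₀, hq₀, hq₀2, hwi₀⟩ := (hwrow i₀).resolve_left hi₀
      obtain ⟨q₁, hq₁, hq₁2, hwi₁⟩ := (hwrow i₁).resolve_left hi₁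
      have hq01 : q₀ ≠ q₁ := by
        intro h
        apply hwdet
        exact Matrix.det_zero_of_row_eq hne01 (by rw [show (Matrix.of w) i₀ = w i₀ from rfl, hwi₀,
          show (Matrix.of w) i₁ = w i₁ from rfl, hwi₁, h])
      set σ : Equiv.Perm (Fin 4) := Equiv.swap 0 i₀ with hσ
      set w' : Fin 4 → Fin 4 → ℝ := w ∘ σ with hw'
      set i : Fin 4 := σ i₁ with hi
      have hi0 : i ≠ 0 := by
        intro h
        rw [hi, hσ, Equiv.swap_apply_eq_iff, Equiv.swap_apply_left] at h
        exact hne01 h.symm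
      have hw'0 : w' 0 = Ql q₀ := by simp [hw', hσ, Equiv.swap_apply_left, hwi₀]
      have hw'i : w' i = Ql q₁ := by
        simp only [hw', hi, Function.comp_apply, hσ, Equiv.swap_apply_self]; exact hwi₁
      have hw'alg : ∀ l k, IsAlgebraic ℚ (w' l k) := fun l k => hwalg _ k
      have hw'det : (Matrix.of w').det ≠ 0 := by
        rw [hw', hdetperm]
        exact mul_ne_zero (by rcases Int.units_eq_one_or (Equiv.Perm.sign σ) with h | h <;> simp [h]) hwdet
      -- cardinality bookkeeping
      have hcard' : (Finset.univ.filter fun l => T (w' l)).card = (Finset.univ.filter fun l => T (w l)).card := by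
        apply Finset.card_equiv σ
        intro l
        simp [hw']
      have hT0 : T (w' 0) := by rw [hw'0]; exact hnotnull q₀ hq₀2
      have hTi : T (w' i) := by rw [hw'i]; exact hnotnull q₁ hq₁2
      have hcard_update : ∀ (j : Fin 4) (u : Fin 4 → ℝ), T (w' j) → ¬ T u →
          (Finset.univ.filter fun l => T (Function.update w' j u l)).card ≤ m := by
        intro j u hj hu
        have hsub : (Finset.univ.filter fun l => T (Function.update w' j u l)) ⊆
            (Finset.univ.filter fun l => T (w' l)).erase j := by
          intro l hl
          simp only [Finset.mem_filter, Finset.mem_univ, true_and] at hl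
          rw [Finset.mem_erase, Finset.mem_filter]
          rcases eq_or_ne l j with rfl | hlj
          · rw [Function.update_self] at hl; exact absurd hl hu
          · rw [Function.update_of_ne hlj] at hl; exact ⟨hlj, Finset.mem_univ _, hl⟩
        have hmem : j ∈ Finset.univ.filter fun l => T (w' l) := by simp [hj]
        calc (Finset.univ.filter fun l => T (Function.update w' j u l)).card
            ≤ ((Finset.univ.filter fun l => T (w' l)).erase j).card := Finset.card_le_card hsub
          _ = (Finset.univ.filter fun l => T (w' l)).card - 1 := Finset.card_erase_of_mem hmem
          _ ≤ m := Nat.sub_le_iff_le_add.mpr (by rw [hcard']; exact hcard)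
      have hP' : P w' := by
        refine red_split_step Ql hQl Spx hSpx ρ P hP w' hw'alg i hi0 q₀ q₁ hq₀ hq₀2 hq₁ hq₁2 hq01 hw'0 hw'i hw'det ?_
        intro u hualg hunull hd0 hdi
        have hTu : ¬ T u := not_not.mpr hunull
        have hrow0 : ∀ l, ((Function.update w' 0 u) l 1 ^ 2 + (Function.update w' 0 u) l 2 ^ 2 =
            (Function.update w' 0 u) l 0 * (Function.update w' 0 u) l 3 ∧ 0 ≤ (Function.update w' 0 u) l 3 ∧
            0 < (Function.update w' 0 u) l 0 + (Function.update w' 0 u) l 3) ∨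
            ∃ q : Fin 3 → ℝ, (∀ k, IsAlgebraic ℚ (q k)) ∧ 0 < q 2 ∧ Function.update w' 0 u l = Ql q := by
          intro l
          rcases eq_or_ne l 0 with rfl | hl
          · left; rw [Function.update_self]; exact hunull
          · rw [Function.update_of_ne hl]; exact hwrow (σ l)
        have hrowi : ∀ l, ((Function.update w' i u) l 1 ^ 2 + (Function.update w' i u) l 2 ^ 2 =
            (Function.update w' i u) l 0 * (Function.update w' i u) l 3 ∧ 0 ≤ (Function.update w' i u) l 3 ∧
            0 < (Function.update w' i u) l 0 + (Function.update w' i u) l 3) ∨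
            ∃ q : Fin 3 → ℝ, (∀ k, IsAlgebraic ℚ (q k)) ∧ 0 < q 2 ∧ Function.update w' i u l = Ql q := by
          intro l
          rcases eq_or_ne l i with rfl | hl
          · left; rw [Function.update_self]; exact hunull
          · rw [Function.update_of_ne hl]; exact hwrow (σ l)
        have halg0 : ∀ l k, IsAlgebraic ℚ (Function.update w' 0 u l k) := by
          intro l k
          rcases eq_or_ne l 0 with rfl | hl
          · rw [Function.update_self]; exact hualg k
          · rw [Function.update_of_ne hl]; exact hw'alg l k
        have halgi : ∀ l k, IsAlgebraic ℚ (Function.update w' i u l k) := by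
          intro l k
          rcases eq_or_ne l i with rfl | hl
          · rw [Function.update_self]; exact hualg k
          · rw [Function.update_of_ne hl]; exact hw'alg l k
        exact ⟨IH _ halg0 hrow0 hd0 (hcard_update 0 u hT0 hTu), IH _ halgi hrowi hdi (hcard_update i u hTi hTu)⟩
      rwa [hw', hPperm] at hP'
    · -- at most one finite vertex
      replace h2 := not_le.mp h2
      rcases Nat.lt_or_ge (Finset.univ.filter fun i => T (w i)).card 1 with h0 | h1
      · have hall : ∀ i, ¬ T (w i) := by
          intro i hi
          have : i ∈ Finset.univ.filter fun i => T (w i) := by simp [hi]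
          have h00 : (Finset.univ.filter fun i => T (w i)) = ∅ := Finset.card_eq_zero.mp (by omega)
          rw [h00] at this
          simp at this
        exact ideal_case w hwalg (fun i => not_not.mp (hall i)) hwdet
      · have hone : (Finset.univ.filter fun i => T (w i)).card = 1 := by omega
        obtain ⟨i₀, hi₀⟩ := Finset.card_eq_one.mp hone
        have hTi₀ : T (w i₀) := by
          have : i₀ ∈ Finset.univ.filter fun i => T (w i) := by rw [hi₀]; simp
          simpa using this
        have hothers : ∀ i, i ≠ i₀ → ¬ T (w i) := by
          intro i hi hT'
          have : i ∈ Finset.univ.filter fun i => T (w i) := by simp [hT']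
          rw [hi₀, Finset.mem_singleton] at this
          exact hi this
        obtain ⟨q₀, hq₀, hq₀2, hwi₀⟩ := (hwrow i₀).resolve_left hTi₀
        exact cone_case w i₀ q₀ hwalg hq₀ hq₀2 hwi₀ (fun i hi => not_not.mp (hothers i hi)) hwdet


/-! ### The `ℚ̄`-tetrahedron sector is the Bloch–Wigner sector -/

/-- **Every `ℚ̄`-tetrahedron class is a tetrahedral combination modulo the moves** (exponent removed): from
`red_simplexAbsorptionTwo` (`2[S] ≡ Σ eⱼ[ρ zⱼ]`), the landed `stub_tetraHalving` (`[ρ zⱼ] ≡ 2([ρ wⱼ] − [ρ wⱼ'])`) and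
the landed integer division `MzvKernelInKZ.Negative.mem_relations_of_nsmul_mem`. [cite: DupontSah1982, §3] -/
theorem simplex_mem_envelope
    (Ql : (Fin 3 → ℝ) → Fin 4 → ℝ) (hQl : ∀ p, Ql p = ![p 0 ^ 2 + p 1 ^ 2 + p 2 ^ 2, p 0, p 1, 1])
    (Spx : (Fin 4 → Fin 4 → ℝ) → Set (Fin 3 → ℝ))
    (hSpx : ∀ v, Spx v = {p | 0 < p 2 ∧ ∀ a, 0 < (Matrix.of v).det * ((Matrix.of v).updateRow a (Ql p)).det})
    (ρ : ℂ → KZ.IntegralRep 3)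
    (hρ : ∀ z, IsAlgebraic ℚ z → 0 < z.im →
      (ρ z).domain = idealTetrahedron z ∧ EqOn (ρ z).integrand (fun p => 1 / p 2 ^ 3) (idealTetrahedron z))
    (v : Fin 4 → Fin 4 → ℝ) (hv : (∀ i k, IsAlgebraic ℚ (v i k)) ∧ (∀ i, (v i 1 ^ 2 + v i 2 ^ 2 = v i 0 * v i 3 ∧ 0 ≤ v i 3 ∧ 0 < v i 0 + v i 3) ∨ ∃ q : Fin 3 → ℝ, (∀ k, IsAlgebraic ℚ (q k)) ∧ 0 < q 2 ∧ v i = Ql q) ∧ (Matrix.of v).det ≠ 0)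
    (r : KZ.IntegralRep 3) (hr : r.domain = Spx v) (hri : EqOn r.integrand (fun p => 1 / p 2 ^ 3) r.domain) :
    ∃ (k : ℕ) (z : Fin k → ℂ) (e : Fin k → ℤ), (∀ i, IsAlgebraic ℚ (z i)) ∧ (∀ i, 0 < (z i).im) ∧
      KZ.of r - ∑ i, e i • KZ.of (ρ (z i)) ∈ KZ.relations := by
  classical
  obtain ⟨hvalg, hrow, hdet⟩ := hv
  have hP := red_simplexAbsorptionTwo Ql hQl Spx hSpx (stub_spxCovariance Ql hQl Spx hSpx) ρ hρ
    (fun v => (∃ r : KZ.IntegralRep 3, r.domain = Spx v ∧ EqOn r.integrand (fun p => 1 / p 2 ^ 3) r.domain) ∧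
      (∀ r : KZ.IntegralRep 3, r.domain = Spx v → EqOn r.integrand (fun p => 1 / p 2 ^ 3) r.domain →
        ∃ (k : ℕ) (z : Fin k → ℂ) (e : Fin k → ℤ), (∀ i, IsAlgebraic ℚ (z i)) ∧ (∀ i, 0 < (z i).im) ∧
          2 • KZ.of r - ∑ i, e i • KZ.of (ρ (z i)) ∈ KZ.relations))
    (fun _ => Iff.rfl) v hvalg hrow hdet
  obtain ⟨k, z, e, hz, hzi, h2⟩ := hP.2 r hr hri
  choose w₁ w₂ hw₁ hw₂ hw₁i hw₂i hhalf using fun i => stub_tetraHalving ρ hρ (z i) (hz i) (hzi i)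
  refine ⟨k + k, Fin.append w₁ w₂, Fin.append e (-e), ?_, ?_, ?_⟩
  · intro i
    refine Fin.addCases (fun j => ?_) (fun j => ?_) i
    · simpa only [Fin.append_left] using hw₁ j
    · simpa only [Fin.append_right] using hw₂ j
  · intro i
    refine Fin.addCases (fun j => ?_) (fun j => ?_) i
    · simpa only [Fin.append_left] using hw₁i j
    · simpa only [Fin.append_right] using hw₂i j
  · rw [Fin.sum_univ_add]
    simp only [Fin.append_left, Fin.append_right, Pi.neg_apply, neg_smul, Finset.sum_neg_distrib]
    have hsum : ∑ i, e i • (KZ.of (ρ (z i)) - 2 • KZ.of (ρ (w₁ i)) + 2 • KZ.of (ρ (w₂ i))) ∈ KZ.relations :=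
      sum_mem fun i _ => zsmul_mem (hhalf i) _
    have key : 2 • (KZ.of r - (∑ i, e i • KZ.of (ρ (w₁ i)) + -∑ i, e i • KZ.of (ρ (w₂ i)))) =
        (2 • KZ.of r - ∑ i, e i • KZ.of (ρ (z i))) +
          ∑ i, e i • (KZ.of (ρ (z i)) - 2 • KZ.of (ρ (w₁ i)) + 2 • KZ.of (ρ (w₂ i))) := by
      simp only [smul_sub, smul_add, Finset.smul_sum, Finset.sum_add_distrib, Finset.sum_sub_distrib,
        smul_neg]
      simp only [smul_comm (2 : ℕ) (e _)]
      abel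
    refine Summit.KontsevichZagierPeriods.MzvKernelInKZ.Negative.mem_relations_of_nsmul_mem
      (n := 2) (by norm_num) ?_
    rw [key]
    exact add_mem h2 hsum

/-- **Absorption of the `ℚ̄`-tetrahedron sector into the tetrahedral oracle**: for the pinned standard family `T`,
every value-relator among `ℚ̄`-tetrahedra of `ℍ³` lies in `relations ⊔ closure (tetrahedral value-relators)` —
`simplex_mem_envelope` and the envelope principle `offTetraSectorKernel_on_envelope`. This is Dupont–Sah's reduction
of the `ℚ̄`-scissors-congruence sector of `ℍ³` to the Bloch–Wigner sector, inside the calculus. [cite: DupontSah1982, §3] -/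
theorem simplexRelators_le :
    ∀ (Ql : (Fin 3 → ℝ) → Fin 4 → ℝ) (hQl : ∀ p, Ql p = ![p 0 ^ 2 + p 1 ^ 2 + p 2 ^ 2, p 0, p 1, 1])
    (Spx : (Fin 4 → Fin 4 → ℝ) → Set (Fin 3 → ℝ))
    (hSpx : ∀ v, Spx v = {p | 0 < p 2 ∧ ∀ a, 0 < (Matrix.of v).det * ((Matrix.of v).updateRow a (Ql p)).det})
    (T : ℂ → Set (Fin 3 → ℝ)) (hT : ∀ z, T z = {p | 0 < p 1 ∧ z.re * p 1 < z.im * p 0 ∧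
      z.im * (p 0 - 1) < (z.re - 1) * p 1 ∧ 0 < p 2 ∧
      0 < z.im * (p 0 ^ 2 + p 1 ^ 2 + p 2 ^ 2 - p 0) + (z.re - Complex.normSq z) * p 1}),
    AddSubgroup.closure {d : KZ.FormalRep |
          ∃ ρs : (Fin 4 → Fin 4 → ℝ) → KZ.IntegralRep 3,
            (∀ v : Fin 4 → Fin 4 → ℝ, ((∀ i k, IsAlgebraic ℚ (v i k)) ∧ (∀ i, (v i 1 ^ 2 + v i 2 ^ 2 = v i 0 * v i 3 ∧ 0 ≤ v i 3 ∧ 0 < v i 0 + v i 3) ∨ ∃ q : Fin 3 → ℝ, (∀ k, IsAlgebraic ℚ (q k)) ∧ 0 < q 2 ∧ v i = Ql q) ∧ (Matrix.of v).det ≠ 0) →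
              (ρs v).domain = Spx v ∧ EqOn (ρs v).integrand (fun p => 1 / p 2 ^ 3) (Spx v)) ∧
            ∃ (k : ℕ) (vs : Fin k → Fin 4 → Fin 4 → ℝ) (m : Fin k → ℤ),
              (∀ l, (∀ i k, IsAlgebraic ℚ (vs l i k)) ∧ (∀ i, (vs l i 1 ^ 2 + vs l i 2 ^ 2 = vs l i 0 * vs l i 3 ∧ 0 ≤ vs l i 3 ∧ 0 < vs l i 0 + vs l i 3) ∨ ∃ q : Fin 3 → ℝ, (∀ k, IsAlgebraic ℚ (q k)) ∧ 0 < q 2 ∧ vs l i = Ql q) ∧ (Matrix.of (vs l)).det ≠ 0) ∧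
              ∑ l, (m l : ℝ) * (ρs (vs l)).value = 0 ∧ d = ∑ l, m l • KZ.of (ρs (vs l))} ≤
      KZ.relations ⊔ AddSubgroup.closure {d : KZ.FormalRep | ∃ ρ : ℂ → KZ.IntegralRep 3,
          (∀ z, IsAlgebraic ℚ z → 0 < z.im → (ρ z).domain = T z ∧
            Set.EqOn (ρ z).integrand (fun p => 1 / p 2 ^ 3) (T z)) ∧
          ∃ (k : ℕ) (z : Fin k → ℂ) (n : Fin k → ℤ), (∀ i, IsAlgebraic ℚ (z i)) ∧ (∀ i, 0 < (z i).im) ∧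
            ∑ i, (n i : ℝ) * (ρ (z i)).value = 0 ∧ d = ∑ i, n i • KZ.of (ρ (z i))} := by
  intro Ql hQl Spx hSpx T hT
  classical
  have hTe : T = idealTetrahedron := funext fun z => (hT z).trans rfl
  subst hTe
  obtain ⟨ρ₀, hρ₀⟩ := exists_tetraFamily
  refine (AddSubgroup.closure_le _).mpr ?_
  rintro d ⟨ρs, hρs, k, vs, m, hadm, hsum, rfl⟩
  have hgen : ∀ l, KZ.of (ρs (vs l)) ∈ AddSubgroup.closure {x : KZ.FormalRep |
      ∃ (k : ℕ) (z : Fin k → ℂ) (e : Fin k → ℤ), (∀ i, IsAlgebraic ℚ (z i)) ∧ (∀ i, 0 < (z i).im) ∧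
        x - ∑ i, e i • KZ.of (ρ₀ (z i)) ∈ KZ.relations} := by
    intro l
    obtain ⟨hdom, hint⟩ := hρs (vs l) (hadm l)
    exact AddSubgroup.subset_closure (simplex_mem_envelope Ql hQl Spx hSpx ρ₀ hρ₀ (vs l) (hadm l)
      (ρs (vs l)) hdom (by rw [hdom]; exact hint))
  have hmem : ∑ l, m l • KZ.of (ρs (vs l)) ∈ AddSubgroup.closure {x : KZ.FormalRep |
      ∃ (k : ℕ) (z : Fin k → ℂ) (e : Fin k → ℤ), (∀ i, IsAlgebraic ℚ (z i)) ∧ (∀ i, 0 < (z i).im) ∧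
        x - ∑ i, e i • KZ.of (ρ₀ (z i)) ∈ KZ.relations} :=
    sum_mem fun l _ => zsmul_mem (hgen l) _
  have h0 : KZ.eval (∑ l, m l • KZ.of (ρs (vs l))) = 0 := by
    simpa [map_sum, map_zsmul, KZ.eval_of, zsmul_eq_mul] using hsum
  exact offTetraSectorKernel_on_envelope idealTetrahedron ρ₀ hρ₀ hmem h0


end Summit.KontsevichZagierPeriods.HyperbolicBloch.OffTetraSectorKernel

end
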